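import Mathlib
import Literature.Probability.LatticeModels.SRWHeatKernelDifferences

/-!
# T⁴ programme, node NE3 (η-rate of the minimisers) — THE FLAT RUNG, part 7: exponentially WEIGHTED ℓ¹ bounds for the
# one-dimensional heat kernel of the continuous-time simple random walk and for its forward difference

Fifteenth generation of the NE3 prover lineage P1 of the cell `pub-balaban`, file 1 (of the free-gradient chain
`SliceFlatHeatOneDim → SliceFlatHeatTorus → SliceFlatFreeResolvent → SliceFlatGradient`, whose end is the last flat stability
reading of the lineage's one type `SliceCovariantLevels.ne3Shape_torusCovE_upto_of_printedStatements` (p199789): item 1 of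
[B9] (3.42) ∕ entries 2–3 of [B5] (1.110), `∇G` and `G∇*`, AT `U = 1`).

The free massive unit-lattice resolvent on the torus is a Laplace transform of the product of one-dimensional torus heat
kernels; its unit forward difference in one direction gains a factor `(1 ∨ t)^{−1/2}` from the differentiated factor.  To turn
this into block-localised row bounds with EXPONENTIAL decay in the block distance and constants uniform in the block side `n`,
the one-dimensional input must be an exponentially weighted ℓ¹ bound with a weight of slope `β = α/n`.  THIS FILE proves, for
the tree's kernel `q_t(m) = srwHeatKernel t m` on `ℤ` (`Literature.Probability.LatticeModels.SRWHeatKernel1D`, after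
Lawler–Limic 2010 §2.3) and every `t > 0`, `T = 1 ∨ t`:
 * §1 elementary inequalities (`x·e^{−x²/16} ≤ 2`, `√t·e^{−t/16} ≤ 2`);
 * §2 HYBRID POINTWISE BOUNDS (Gaussian regime + Poisson regime of the tree's Chernoff bounds
   `abs_srwHeatKernel_le_of_nonneg`, `abs_fwdDiff_srwHeatKernel_le_exp`):
   `|q_t(m)| ≤ T^{−1/2}(e^{−m²/(8T)} + e^{−|m|/8})` and `|q_t(m+1) − q_t(m)| ≤ 15·T^{−1}(e^{−m²/(16T)} + e^{−|m|/16})`;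
 the companion `SliceFlatHeatWeighted` sums these against the weights `e^{β|m|}` (§3 weighted geometric ∕ Gaussian series,
 §4 the weighted ℓ¹ bounds `Σ_m e^{β|m|}|q_t(m)| ≤ 48·e^{4β²T}`, `Σ_m e^{β|m|}|q_t(m+1) − q_t(m)| ≤ 1260·T^{−1/2}·e^{8β²T}`).
All constants are absolute.  Nothing here is specific to a gauge theory.

Honest framing: finite-T⁴ ultraviolet bookkeeping about MINIMISERS (rung (B)+1 of the cell's ladder); no conditional of the
cell (`BetaPertH`, (B), (B^μ)) is used or hidden; nothing bears on infinite volume, a mass gap, or the Clay problem; NE3 is NOT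
proved by this file.  ABSOLUTE RULE of the cell kept: the only inputs are Mathlib and kernel-proved tree modules
(`Literature.Probability.LatticeModels.SRWHeatKernel1D`, `…SRWHeatKernelDifferences`); every declaration is [folklore] classical
analysis, no `def … : Prop`, no `sorry`, no axioms beyond Mathlib's.  PLACEMENT (human rule 2026-08-19): cell work under
`Summits/QuantumFields/BalabanUV/`; moves nothing.  Records: `t4/T4-EST-U1b-OSC.md` v1.32, `t4/T4-EST-NE3-P1.md` v2.31 of
the cell `pub-balaban`.
-/

noncomputable section

open Real Finset Filter

namespace Summit.QuantumFields.BalabanUV.T4Continuum.SliceFlatHeatOneDim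

open Literature.Probability.LatticeModels

/-! ## §1  Elementary inequalities -/
section Elementary

/-- `x·e^{−x²/16} ≤ 2` (from `1 + x²/16 ≤ e^{x²/16}` and `x/2 ≤ 1 + x²/16`). [folklore] -/
theorem mul_exp_neg_sq_div_le_two (x : ℝ) : x * Real.exp (-(x ^ 2 / 16)) ≤ 2 := by
  have h1 : x ^ 2 / 16 + 1 ≤ Real.exp (x ^ 2 / 16) := Real.add_one_le_exp _
  have h2 : x / 2 ≤ x ^ 2 / 16 + 1 := by nlinarith [sq_nonneg (x / 4 - 1)]
  have h3 : Real.exp (x ^ 2 / 16) * Real.exp (-(x ^ 2 / 16)) = 1 := by rw [← Real.exp_add, add_neg_cancel, Real.exp_zero]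
  calc x * Real.exp (-(x ^ 2 / 16)) ≤ (2 * Real.exp (x ^ 2 / 16)) * Real.exp (-(x ^ 2 / 16)) := by
        gcongr; linarith
    _ = 2 := by rw [mul_assoc, h3, mul_one]

/-- `√t·e^{−t/16} ≤ 2` for `t ≥ 0` (AM–GM `√t/2 ≤ 1 + t/16 ≤ e^{t/16}`). [folklore] -/
theorem sqrt_mul_exp_neg_div_le_two {t : ℝ} (ht : 0 ≤ t) : Real.sqrt t * Real.exp (-(t / 16)) ≤ 2 := by
  have h1 : t / 16 + 1 ≤ Real.exp (t / 16) := Real.add_one_le_exp _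
  have hs : Real.sqrt t ^ 2 = t := Real.sq_sqrt ht
  have h2 : Real.sqrt t / 2 ≤ t / 16 + 1 := by nlinarith [sq_nonneg (Real.sqrt t / 4 - 1), Real.sqrt_nonneg t]
  have h3 : Real.exp (t / 16) * Real.exp (-(t / 16)) = 1 := by rw [← Real.exp_add, add_neg_cancel, Real.exp_zero]
  calc Real.sqrt t * Real.exp (-(t / 16)) ≤ (2 * Real.exp (t / 16)) * Real.exp (-(t / 16)) := by
        gcongr; linarith
    _ = 2 := by rw [mul_assoc, h3, mul_one]

/-- `T = 1 ∨ t` bookkeeping: `T ≥ 1`, `T > 0`, `T^{−1/2} ≤ 1`, `T^{−1/2}·T^{−1/2} = T⁻¹`, `√T · T^{−1/2} = 1`. [folklore] -/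
theorem max_one_facts (t : ℝ) :
    1 ≤ max 1 t ∧ 0 < max 1 t ∧ (max 1 t) ^ (-(1 / 2 : ℝ)) ≤ 1 ∧
      (max 1 t) ^ (-(1 / 2 : ℝ)) * (max 1 t) ^ (-(1 / 2 : ℝ)) = (max 1 t)⁻¹ ∧
      Real.sqrt (max 1 t) * (max 1 t) ^ (-(1 / 2 : ℝ)) = 1 := by
  have h1 : (1 : ℝ) ≤ max 1 t := le_max_left _ _
  have h0 : (0 : ℝ) < max 1 t := by positivity
  refine ⟨h1, h0, ?_, ?_, ?_⟩
  · exact Real.rpow_le_one_of_one_le_of_nonpos h1 (by norm_num)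
  · rw [← Real.rpow_add h0]; norm_num [Real.rpow_neg_one]
  · rw [Real.sqrt_eq_rpow, ← Real.rpow_add h0]; norm_num

end Elementary

/-! ## §2  Hybrid pointwise bounds: Gaussian regime + Poisson regime -/
section Pointwise

/-- **Hybrid pointwise bound for the heat kernel**: `|q_t(m)| ≤ T^{−1/2}(e^{−m²/(8T)} + e^{−|m|/8})`, `T = 1 ∨ t`, for all
`t > 0`, `m ∈ ℤ` (the tree's two Chernoff regimes, added up; negative `m` by evenness). [folklore] -/
theorem abs_srw_le_hybrid {t : ℝ} (ht : 0 < t) (m : ℤ) :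
    |srwHeatKernel t m| ≤ (max 1 t) ^ (-(1 / 2 : ℝ)) *
      (Real.exp (-((m : ℝ) ^ 2 / (8 * max 1 t))) + Real.exp (-(|(m : ℝ)| / 8))) := by
  obtain ⟨hT1, hT0, -, -, -⟩ := max_one_facts t
  wlog hm : 0 ≤ m generalizing m
  · have h := this (-m) (by omega)
    rw [srwHeatKernel_neg] at h
    simpa using h
  have hmr : (0 : ℝ) ≤ m := by exact_mod_cast hm
  have habs : |(m : ℝ)| = m := abs_of_nonneg hmr
  rw [habs]
  obtain ⟨hg, hp⟩ := abs_srwHeatKernel_le_of_nonneg ht hm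
  have hA : 0 ≤ Real.exp (-((m : ℝ) ^ 2 / (8 * max 1 t))) := (Real.exp_pos _).le
  have hB : 0 ≤ Real.exp (-((m : ℝ) / 8)) := (Real.exp_pos _).le
  have hTn : 0 ≤ (max 1 t) ^ (-(1 / 2 : ℝ)) := Real.rpow_nonneg hT0.le _
  rcases le_total (m : ℝ) t with hmt | hmt
  · -- Gaussian regime; if `m ≠ 0` then `t ≥ 1` and `T = t`
    have h1 := hg hmt
    have h2 : Real.exp (-((m : ℝ) ^ 2 / (8 * t))) ≤ Real.exp (-((m : ℝ) ^ 2 / (8 * max 1 t))) := by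
      refine Real.exp_le_exp.2 (neg_le_neg (div_le_div_of_nonneg_left (sq_nonneg _) (by positivity) ?_))
      exact mul_le_mul_of_nonneg_left (le_max_right _ _) (by norm_num)
    calc |srwHeatKernel t m| ≤ Real.exp (-((m : ℝ) ^ 2 / (8 * t))) * (max 1 t) ^ (-(1 / 2 : ℝ)) := h1
      _ ≤ Real.exp (-((m : ℝ) ^ 2 / (8 * max 1 t))) * (max 1 t) ^ (-(1 / 2 : ℝ)) :=
          mul_le_mul_of_nonneg_right h2 hTn
      _ ≤ _ := by rw [mul_comm]; exact mul_le_mul_of_nonneg_left (le_add_of_nonneg_right hB) hTn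
  · have h1 := hp hmt
    calc |srwHeatKernel t m| ≤ Real.exp (-((m : ℝ) / 8)) * (max 1 t) ^ (-(1 / 2 : ℝ)) := h1
      _ ≤ _ := by rw [mul_comm]; exact mul_le_mul_of_nonneg_left (le_add_of_nonneg_left hA) hTn

/-- The absolute constant of the hybrid difference bound: `(68 + 8π)/(2π) ≤ 15`. [folklore] -/
theorem diffConst_le : (68 + 8 * π) / (2 * π) ≤ 15 := by
  rw [div_le_iff₀ (by positivity)]
  nlinarith [Real.pi_gt_d2]

/-- **Hybrid pointwise bound for the forward difference**: `|q_t(m+1) − q_t(m)| ≤ 15·T^{−1}(e^{−m²/(16T)} + e^{−|m|/16})`,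
`T = 1 ∨ t`, for all `t > 0`, `m ∈ ℤ`.  From the tree's Chernoff bound `abs_fwdDiff_srwHeatKernel_le_exp` with the shift
`λ = m/t` in the Gaussian regime `|m| ≤ t` (`chernoff_exponent_gauss_le`; the term `|λ|T^{−1/2}e^{−m²/(8t)}` is
`≤ 2T^{−1}e^{−m²/(16t)}` by `x e^{−x²/16} ≤ 2`) and `λ = ±1` in the Poisson regime `|m| > t` (`chernoff_exponent_poisson_le`;
`T^{−1/2}e^{−|m|/16} ≤ 2T^{−1}` by `√t e^{−t/16} ≤ 2`). [folklore] -/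
theorem abs_fwdDiff_srw_le_hybrid {t : ℝ} (ht : 0 < t) (m : ℤ) :
    |srwHeatKernel t (m + 1) - srwHeatKernel t m| ≤ 15 * (max 1 t)⁻¹ *
      (Real.exp (-((m : ℝ) ^ 2 / (16 * max 1 t))) + Real.exp (-(|(m : ℝ)| / 16))) := by
  obtain ⟨hT1, hT0, hThalf, hTT, hsq⟩ := max_one_facts t
  have h2π : (0 : ℝ) < 2 * π := by positivity
  set D := |srwHeatKernel t (m + 1) - srwHeatKernel t m| with hD
  have hD0 : 0 ≤ D := abs_nonneg _
  have hA : 0 ≤ Real.exp (-((m : ℝ) ^ 2 / (16 * max 1 t))) := (Real.exp_pos _).le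
  have hB : 0 ≤ Real.exp (-(|(m : ℝ)| / 16)) := (Real.exp_pos _).le
  have hTinv : 0 ≤ (max 1 t)⁻¹ := inv_nonneg.2 hT0.le
  have hTn : 0 ≤ (max 1 t) ^ (-(1 / 2 : ℝ)) := Real.rpow_nonneg hT0.le _
  -- it suffices to bound `2π·D` by `(68 + 8π)·T⁻¹·(…)`
  suffices hmain : 2 * π * D ≤ (68 + 8 * π) * (max 1 t)⁻¹ *
      (Real.exp (-((m : ℝ) ^ 2 / (16 * max 1 t))) + Real.exp (-(|(m : ℝ)| / 16))) by
    have h1 : D ≤ (68 + 8 * π) / (2 * π) * (max 1 t)⁻¹ *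
        (Real.exp (-((m : ℝ) ^ 2 / (16 * max 1 t))) + Real.exp (-(|(m : ℝ)| / 16))) := by
      rw [div_mul_eq_mul_div, div_mul_eq_mul_div, le_div_iff₀ h2π]; linarith
    exact h1.trans (mul_le_mul_of_nonneg_right (mul_le_mul_of_nonneg_right diffConst_le hTinv) (add_nonneg hA hB))
  rcases le_or_gt (|(m : ℝ)|) t with hmt | hmt
  · -- Gaussian regime, shift `λ = m/t`
    have hl : |(m : ℝ) / t| ≤ 1 := by rw [abs_div, abs_of_pos ht, div_le_one ht]; exact hmt
    have h := abs_fwdDiff_srwHeatKernel_le_exp ht.le m hl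
    have hexp : Real.exp (-((m : ℝ) / t * m) + t * (Real.cosh ((m : ℝ) / t) - 1)) ≤ Real.exp (-((m : ℝ) ^ 2 / (8 * t))) :=
      Real.exp_le_exp.2 (chernoff_exponent_gauss_le ht hmt)
    rcases eq_or_ne m 0 with hm0 | hm0
    · -- `m = 0`: `λ = 0`
      subst hm0
      have h' : 2 * π * D ≤ 68 * (max 1 t)⁻¹ := by
        rw [hD]
        refine h.trans (le_of_eq ?_)
        simp
      have e1 : Real.exp (-(((0 : ℤ) : ℝ) ^ 2 / (16 * max 1 t))) + Real.exp (-(|((0 : ℤ) : ℝ)| / 16)) = 2 := by norm_num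
      rw [e1]
      nlinarith [Real.pi_pos, hTinv]
    · -- `m ≠ 0`: then `1 ≤ |m| ≤ t`, `T = t`
      have hm1 : (1 : ℝ) ≤ |(m : ℝ)| := by
        rw [← Int.cast_abs]; exact_mod_cast Int.one_le_abs hm0
      have ht1 : 1 ≤ t := hm1.trans hmt
      have hTt : max 1 t = t := max_eq_right ht1
      rw [hTt] at hTT hsq ⊢
      -- the Gaussian factor splits: `e^{−m²/8t} = e^{−m²/16t}·e^{−m²/16t}`
      have hsplit : Real.exp (-((m : ℝ) ^ 2 / (8 * t))) =
          Real.exp (-((m : ℝ) ^ 2 / (16 * t))) * Real.exp (-((m : ℝ) ^ 2 / (16 * t))) := by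
        rw [← Real.exp_add]; congr 1; field_simp; ring
      -- `|λ|·t^{−1/2}·e^{−m²/16t} ≤ 2 t⁻¹`
      have hkey : |(m : ℝ) / t| * t ^ (-(1 / 2 : ℝ)) * Real.exp (-((m : ℝ) ^ 2 / (16 * t))) ≤ 2 * t⁻¹ := by
        have hxe : (|(m : ℝ)| * t ^ (-(1 / 2 : ℝ))) ^ 2 / 16 = (m : ℝ) ^ 2 / (16 * t) := by
          rw [mul_pow, sq_abs, pow_two (t ^ (-(1 / 2 : ℝ))), hTT]; field_simp
        have h2 := mul_exp_neg_sq_div_le_two (|(m : ℝ)| * t ^ (-(1 / 2 : ℝ)))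
        rw [hxe] at h2
        rw [abs_div, abs_of_pos ht]
        calc |(m : ℝ)| / t * t ^ (-(1 / 2 : ℝ)) * Real.exp (-((m : ℝ) ^ 2 / (16 * t)))
            = t⁻¹ * (|(m : ℝ)| * t ^ (-(1 / 2 : ℝ)) * Real.exp (-((m : ℝ) ^ 2 / (16 * t)))) := by
              rw [div_eq_mul_inv]; ring
          _ ≤ t⁻¹ * 2 := mul_le_mul_of_nonneg_left h2 (inv_nonneg.2 ht.le)
          _ = 2 * t⁻¹ := mul_comm _ _
      have hexp16 : Real.exp (-((m : ℝ) ^ 2 / (16 * t))) ≤ 1 := by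
        rw [Real.exp_le_one_iff]; exact neg_nonpos.2 (by positivity)
      calc 2 * π * D ≤ Real.exp (-((m : ℝ) / t * m) + t * (Real.cosh ((m : ℝ) / t) - 1)) *
            (68 * t⁻¹ + 2 * |(m : ℝ) / t| * (2 * π * t ^ (-(1 / 2 : ℝ)))) := by rw [hTt] at h; exact h
        _ ≤ Real.exp (-((m : ℝ) ^ 2 / (8 * t))) * (68 * t⁻¹ + 2 * |(m : ℝ) / t| * (2 * π * t ^ (-(1 / 2 : ℝ)))) :=
            mul_le_mul_of_nonneg_right hexp (by positivity)
        _ = Real.exp (-((m : ℝ) ^ 2 / (16 * t))) * (68 * t⁻¹ * Real.exp (-((m : ℝ) ^ 2 / (16 * t))) +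
              4 * π * (|(m : ℝ) / t| * t ^ (-(1 / 2 : ℝ)) * Real.exp (-((m : ℝ) ^ 2 / (16 * t))))) := by
            rw [hsplit]; ring
        _ ≤ Real.exp (-((m : ℝ) ^ 2 / (16 * t))) * (68 * t⁻¹ * 1 + 4 * π * (2 * t⁻¹)) := by
            gcongr
        _ = (68 + 8 * π) * t⁻¹ * Real.exp (-((m : ℝ) ^ 2 / (16 * t))) := by ring
        _ ≤ (68 + 8 * π) * t⁻¹ * (Real.exp (-((m : ℝ) ^ 2 / (16 * t))) + Real.exp (-(|(m : ℝ)| / 16))) := by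
            have : 0 ≤ (68 + 8 * π) * t⁻¹ := by positivity
            exact mul_le_mul_of_nonneg_left (le_add_of_nonneg_right hB) this
  · -- Poisson regime, shift `λ = ±1`
    have hm0 : m ≠ 0 := by rintro rfl; simp at hmt; linarith
    -- choose the sign
    obtain ⟨lam, hlam1, hlamm⟩ : ∃ lam : ℝ, |lam| = 1 ∧ lam * m = |(m : ℝ)| := by
      rcases lt_or_gt_of_ne hm0 with hneg | hpos
      · refine ⟨-1, by simp, ?_⟩
        have : (m : ℝ) < 0 := by exact_mod_cast hneg
        rw [abs_of_neg this]; ring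
      · refine ⟨1, by simp, ?_⟩
        have : (0 : ℝ) < m := by exact_mod_cast hpos
        rw [abs_of_pos this]; ring
    have h := abs_fwdDiff_srwHeatKernel_le_exp ht.le m (le_of_eq hlam1)
    rw [hlam1, hlamm] at h
    have hcosh : Real.cosh lam = Real.cosh 1 := by
      rcases (abs_eq (zero_le_one)).1 hlam1 with h1 | h1 <;> simp [h1]
    rw [hcosh] at h
    have hexp : Real.exp (-|(m : ℝ)| + t * (Real.cosh 1 - 1)) ≤ Real.exp (-(|(m : ℝ)| / 8)) :=
      Real.exp_le_exp.2 (chernoff_exponent_poisson_le ht.le hmt.le)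
    have hsplit : Real.exp (-(|(m : ℝ)| / 8)) = Real.exp (-(|(m : ℝ)| / 16)) * Real.exp (-(|(m : ℝ)| / 16)) := by
      rw [← Real.exp_add]; congr 1; ring
    -- `e^{−|m|/16} ≤ e^{−t/16}` and `T^{−1/2}·e^{−t/16} ≤ 2 T⁻¹`
    have hkey : (max 1 t) ^ (-(1 / 2 : ℝ)) * Real.exp (-(|(m : ℝ)| / 16)) ≤ 2 * (max 1 t)⁻¹ := by
      have hm1 : (1 : ℝ) ≤ |(m : ℝ)| := by rw [← Int.cast_abs]; exact_mod_cast Int.one_le_abs hm0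
      have hTm : max 1 t ≤ |(m : ℝ)| := max_le hm1 hmt.le
      have h1 : Real.exp (-(|(m : ℝ)| / 16)) ≤ Real.exp (-(max 1 t / 16)) := Real.exp_le_exp.2 (by linarith)
      have h2 := sqrt_mul_exp_neg_div_le_two hT0.le
      calc (max 1 t) ^ (-(1 / 2 : ℝ)) * Real.exp (-(|(m : ℝ)| / 16))
          ≤ (max 1 t) ^ (-(1 / 2 : ℝ)) * Real.exp (-(max 1 t / 16)) := mul_le_mul_of_nonneg_left h1 hTn
        _ = (max 1 t)⁻¹ * (Real.sqrt (max 1 t) * Real.exp (-(max 1 t / 16))) := by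
            have e : (max 1 t) ^ (-(1 / 2 : ℝ)) = (max 1 t)⁻¹ * Real.sqrt (max 1 t) := by
              calc (max 1 t) ^ (-(1 / 2 : ℝ))
                  = (max 1 t) ^ (-(1 / 2 : ℝ)) * (Real.sqrt (max 1 t) * (max 1 t) ^ (-(1 / 2 : ℝ))) := by rw [hsq, mul_one]
                _ = ((max 1 t) ^ (-(1 / 2 : ℝ)) * (max 1 t) ^ (-(1 / 2 : ℝ))) * Real.sqrt (max 1 t) := by ring
                _ = (max 1 t)⁻¹ * Real.sqrt (max 1 t) := by rw [hTT]
            rw [e]; ring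
        _ ≤ (max 1 t)⁻¹ * 2 := mul_le_mul_of_nonneg_left h2 hTinv
        _ = 2 * (max 1 t)⁻¹ := mul_comm _ _
    have hexp16 : Real.exp (-(|(m : ℝ)| / 16)) ≤ 1 := by
      rw [Real.exp_le_one_iff]; exact neg_nonpos.2 (by positivity)
    calc 2 * π * D ≤ Real.exp (-|(m : ℝ)| + t * (Real.cosh 1 - 1)) *
          (68 * (max 1 t)⁻¹ + 2 * 1 * (2 * π * (max 1 t) ^ (-(1 / 2 : ℝ)))) := h
      _ ≤ Real.exp (-(|(m : ℝ)| / 8)) * (68 * (max 1 t)⁻¹ + 2 * 1 * (2 * π * (max 1 t) ^ (-(1 / 2 : ℝ)))) :=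
          mul_le_mul_of_nonneg_right hexp (by positivity)
      _ = Real.exp (-(|(m : ℝ)| / 16)) * (68 * (max 1 t)⁻¹ * Real.exp (-(|(m : ℝ)| / 16)) +
            4 * π * ((max 1 t) ^ (-(1 / 2 : ℝ)) * Real.exp (-(|(m : ℝ)| / 16)))) := by rw [hsplit]; ring
      _ ≤ Real.exp (-(|(m : ℝ)| / 16)) * (68 * (max 1 t)⁻¹ * 1 + 4 * π * (2 * (max 1 t)⁻¹)) := by gcongr
      _ = (68 + 8 * π) * (max 1 t)⁻¹ * Real.exp (-(|(m : ℝ)| / 16)) := by ring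
      _ ≤ (68 + 8 * π) * (max 1 t)⁻¹ * (Real.exp (-((m : ℝ) ^ 2 / (16 * max 1 t))) + Real.exp (-(|(m : ℝ)| / 16))) := by
          have : 0 ≤ (68 + 8 * π) * (max 1 t)⁻¹ := by positivity
          exact mul_le_mul_of_nonneg_left (le_add_of_nonneg_left hA) this

end Pointwise

end Summit.QuantumFields.BalabanUV.T4Continuum.SliceFlatHeatOneDim
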